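import Literature.NumberTheory.Automorphic.UnitaryThreeRamifiedTorusWeightPrelims     -- ★ γ2′ weight′ PART 1 (p841852)
import Literature.NumberTheory.Automorphic.UnitaryThreeRamifiedTorusBlocks            -- ★ γ2′ hA′ PART 1 p841802 (1-units are norms, ramified torus blocks)
import Literature.NumberTheory.LocalFields.UnramifiedQuadraticNormFixedPoints         -- ★ B-p10: `natCard_fixed_quotient_pow`, `exists_fixed_sub_mem`
import HarnessLib

/-!
# Flicker's Proposition 6 (c), RAMIFIED torus, in the `U(Φ₃)` frame — THE WEIGHT `[T_H : T_H ∩ r_j K_H r_j⁻¹] = q^j`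
(Flicker (1998), *Elementary proof of the fundamental lemma for a unitary group*, Prop. 6 (second half) p. 83: for the type-(2) torus `T_H ≅ (EL)¹`,
`r_j⁻¹ T_H r_j ∩ K_H = R_L(j)¹`, `R_L(j) = R + π^j R_L`, and `[R_L¹ : R_L(j)¹] = q^j`)

Topic `NumberTheory/Automorphic`; namespace `Literature.NumberTheory.Automorphic.UnitaryGroup`.  KERNEL mathematics only: theorems, no definition, no
named fact, no instance, no notation, no `sorry`.  Cell `pub/hodgecm-mathlib`, programme P3a, road «D-N7-inert», MAP v3 «N7-ns COUNT FROM FLICKER», brick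
γ2′ «THE RAMIFIED ∕ TYPE-(2) TRANSPORT» — FILE `weight′` PART 2 (LEAD F0P3a-plan (g9) T8-84 (2); A-p03 (g24) 06:08:25Z «`= q^j` EXACTLY for every `j`»; consumer:
B-p04 (g33)'s ★ p840967 `FixedPointsTorusDoubleCosetCount` ∕ Cor. 9 at the type-(2) torus and ★ B-p14 `sum_pow_mul_innerSumTen_eq_phiTH`).  HC_CM is proved only
modulo the printed citations (2 remaining named inputs hLiu418, h413) until rung 0 closes; this file discharges no named fact.

MATHEMATICS (an `S`-free proof — no ring of integers of `EL` is needed).  `T_H = Z_H(t′)` consists of the blocks `!![p,0,ρq;0,e,0;q,0,p]` with `|p| = 1`,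
`|q| ≤ 1` (★ PART 1); the coordinate **`y(τ) := q∕(dp) ∈ F`** (`σ`-fixed) satisfies the TWISTED ADDITION LAW `y(τ₁τ₂) = (y₁ + y₂)∕(1 + π₀y₁y₂)`, `π₀ = d²ρ`
(`|π₀| = |ϖ|`).  The conjugate `r_j⁻¹ τ r_j` is integral iff `|q| ≤ |ϖ|^j` (both parities, ★ PART 1), so `S_j := T_H ∩ r_jK_Hr_j⁻¹ = {|y| ≤ |ϖ|^j}`, and
`τ₁⁻¹τ₂ ∈ S_j ⟺ |y₁ − y₂| ≤ |ϖ|^j` (the law, with `|1 − π₀y₁y₂| = 1`).  Hence `τS_j ↦ y(τ) mod 𝔪^j` is a well-defined injection `T_H ⧸ S_j ↪ R ⧸ 𝔪^j` with image the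
`σ̄`-FIXED classes (every fixed class has a `σ`-fixed representative `y₀` (★ `exists_fixed_sub_mem`), and `τ = μ⁻¹·D₁⁻¹ι(1 + y₀√π₀)D₁ ⊕ 1 ∈ T_H` with
`μσμ = 1 − π₀y₀²` (★ 1-units are norms) has `y(τ) = y₀`).  Therefore **`[T_H : S_j] = #Fix(σ̄ on R ⧸ 𝔪^j) = q^j`** (★ B-p10 `natCard_fixed_quotient_pow`, `#𝓀_R = q²`).

References: [Flicker1998UnitaryFL] Y. Z. Flicker, Canad. J. Math. 50 (1998), Prop. 6 (c) p. 83, Prop. 7 p. 84 · [Serre1979] J.-P. Serre, *Local Fields*, GTM 67,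
Ch. V §2 Prop. 2–3 · [Rogawski1990] J. D. Rogawski, Ann. of Math. Stud. 123, §4.9 p. 55. -/

set_option autoImplicit false

open Matrix
open scoped MatrixGroups WithZero

namespace Literature.NumberTheory.Automorphic.UnitaryGroup

open Literature.NumberTheory.Automorphic.HermitianLattice (unitaryInt LocalConjDatum)
open Literature.NumberTheory.LocalFields.UnramifiedQuadraticNorm (maximalIdeal_pow_le_comap exists_fixed_sub_mem natCard_fixed_quotient_pow)
open IsLocalRing

universe u

section Weight

variable {K : Type*} [Field K] [Valued K ℤᵐ⁰] {ϖ : K} (σ : K →+* K) {J : Matrix (Fin 3) (Fin 3) K}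
  (hJ : J = (StdForm.antidiagonal 3).over K) (hd : LocalConjDatum σ ϖ)

/-- Cancellation in `ℤᵐ⁰`: `c ≠ 0`, `c·x ≤ c·y ⇒ x ≤ y`. [cite: Flicker1998UnitaryFL, Prop. 6 (c) p. 83] -/
private theorem le_of_mul_le_mul_left₀'' {c x y : ℤᵐ⁰} (hc : c ≠ 0) (h : c * x ≤ c * y) : x ≤ y := by
  have h1 := mul_le_mul_right h c⁻¹
  rwa [← mul_assoc, ← mul_assoc, inv_mul_cancel₀ hc, one_mul, one_mul] at h1

set_option maxHeartbeats 1600000 in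
-- one long explicit computation (the coordinate `y = q∕(dp)`, its addition law, the integrality criterion in two parities, and the bijection with `Fix(σ̄_j)`)
include hJ hd in
/-- **FLICKER'S PROPOSITION 6 (c), TYPE-(2) TORUS — THE WEIGHT `[T_H : T_H ∩ r_j K_H r_j⁻¹] = q^j`** (EXACTLY, for every `j ≥ 0`), in the `U(Φ₃)` frame:
`T_H = Z_H(t′)` for the regular ramified torus block `t′ = !![A,0,B;0,b₀,0;C,0,A]` (`C ≠ 0`, `B = Cρ`, `|ρ| = |ϖ|`), `r(2a) = diag(ϖ^{−a},1,ϖ^{a})`, `r(2a+1)` with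
corner `(0, ϖ^{a+1}∕d; −dϖ^{−(a+1)}, 0)` (★ `exists_ramifiedRep`), `K_H = flickerKH`; `q² = #𝓀_R` through the bridge `(R, ι)` (`R := 𝒪[K]` at the junction), `R`
complete for `𝔪`.  The per-`j` factor of ★ B-p04 `natCard_fixedPoints_centralizer_eq_finsum` (Cor. 9) at the type-(2) torus, in its requested spelling.
[cite: Flicker1998UnitaryFL, Prop. 6 (c) p. 83] [cite: Serre1979, Ch. V §2 Prop. 2–3] -/
theorem relIndex_flickerKH_conj_ramifiedRep_eq
    {R : Type u} [CommRing R] [IsDomain R] [IsDiscreteValuationRing R] [IsAdicComplete (IsLocalRing.maximalIdeal R) R]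
    (ι : R →+* K) (hι : Function.Injective ι)
    (hιv : ∀ x : K, Valued.v x ≤ 1 ↔ x ∈ Set.range ι) (σR : R →+* R) (hσR : ∀ r, σR (σR r) = r) (hσι : ∀ r, ι (σR r) = σ (ι r))
    {dR : R} (hdRσ : σR dR = -dR) (hdRu : IsUnit dR) (h2R : IsUnit (2 : R)) {ϖR : R} (hϖR : Irreducible ϖR) (hιϖ : ι ϖR = ϖ)
    {q₀ : ℕ} (hq : Nat.card (ResidueField R) = q₀ ^ 2)
    {c : ↥(unitaryGroupOfForm σ J)} (hc : ((c : GL (Fin 3) K) : Matrix (Fin 3) (Fin 3) K) = !![1, 0, 0; 0, -1, 0; 0, 0, 1])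
    {ρ : K} (hρ : Valued.v ρ = Valued.v ϖ)
    {t : ↥(unitaryGroupOfForm σ J)} (htH : t ∈ Subgroup.centralizer ({c} : Set ↥(unitaryGroupOfForm σ J))) {A B C b₀ : K}
    (hte : ((t : GL (Fin 3) K) : Matrix (Fin 3) (Fin 3) K) = !![A, 0, B; 0, b₀, 0; C, 0, A]) (hC : C ≠ 0) (hBC : B = C * ρ)
    (r : ℕ → ↥(Subgroup.centralizer ({c} : Set ↥(unitaryGroupOfForm σ J))))
    (hr0 : ∀ a : ℕ, (((r (2 * a) : ↥(unitaryGroupOfForm σ J)) : GL (Fin 3) K) : Matrix (Fin 3) (Fin 3) K) = !![(ϖ ^ a)⁻¹, 0, 0; 0, 1, 0; 0, 0, ϖ ^ a])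
    (hr1 : ∀ a : ℕ, (((r (2 * a + 1) : ↥(unitaryGroupOfForm σ J)) : GL (Fin 3) K) : Matrix (Fin 3) (Fin 3) K) =
      !![0, 0, ϖ ^ (a + 1) / ι dR; 0, 1, 0; -ι dR * (ϖ ^ (a + 1))⁻¹, 0, 0])
    (j : ℕ) :
    ((((flickerKH σ J c).subgroupOf (Subgroup.centralizer ({c} : Set ↥(unitaryGroupOfForm σ J)))).map (MulAut.conj (r j)).toMonoidHom).relIndex
        (Subgroup.centralizer ({⟨t, htH⟩} : Set ↥(Subgroup.centralizer ({c} : Set ↥(unitaryGroupOfForm σ J)))))) = q₀ ^ j := by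
  classical
  -- scalar facts
  have h2 : (2 : K) ≠ 0 := fun h0 => by have := hd.v2; rw [h0, map_zero] at this; exact zero_ne_one this
  have hϖ0 : ϖ ≠ 0 := fun h0 => by have := hd.vϖ; rw [h0, map_zero] at this; exact WithZero.zero_ne_coe this
  have hvϖ := hd.vϖ
  have hσϖ : σ ϖ = ϖ := hd.σϖ
  have hvϖ0 : Valued.v ϖ ≠ 0 := (Valuation.ne_zero_iff _).2 hϖ0
  have hvϖ1 : Valued.v ϖ ≤ 1 := by rw [hvϖ, ← WithZero.exp_zero, WithZero.exp_le_exp]; norm_num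
  set d : K := ι dR with hd_def
  have hdK : σ d = -d := by rw [hd_def, ← hσι, hdRσ, map_neg]
  have hvd : Valued.v d = 1 := TorusBridge.v_eq_one_of_isUnit ι hιv hdRu
  have hd0 : d ≠ 0 := fun h0 => by rw [h0, map_zero] at hvd; exact zero_ne_one hvd
  have ha : IsUnit (σR dR - dR) := by
    have e1 : σR dR - dR = -(2 * dR) := by rw [hdRσ]; ring
    rw [e1]; exact (h2R.mul hdRu).neg
  have hvρ1 : Valued.v ρ ≤ 1 := by rw [hρ]; exact hvϖ1
  -- `π₀ = d²ρ` is `σ`-fixed (read off `t ∈ H` through ★ γ0's dictionary)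
  set π₀ : K := d ^ 2 * ρ with hπ₀
  have hvπ₀ : Valued.v π₀ = WithZero.exp (-1 : ℤ) := by rw [hπ₀, map_mul, map_pow, hvd, one_pow, one_mul, hρ, hvϖ]
  have ht3 : ((t : GL (Fin 3) K)) ∈ unitaryGroupOfForm σ ((StdForm.antidiagonal 3).over K) := by rw [← hJ]; exact t.2
  obtain ⟨⟨lt, hlt0, -, -, f2t, f3t, -, -⟩, -⟩ := SplitDictionary.exists_fixed_coords_of_coe_eq_block σ h2 hdK hd0 ht3 hte
  have hσπ₀ : σ π₀ = π₀ := by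
    have e1 : π₀ = (d * B / lt) / (C / (d * lt)) := by rw [hπ₀, hBC]; field_simp
    rw [e1, map_div₀, f2t, f3t]
  -- the matrix `M τ` of `τ ∈ T_H`, its shape `!![p,0,ρq;0,e,0;q,0,p]` and valuations
  obtain ⟨M, hMdef⟩ : ∃ M : ↥(Subgroup.centralizer ({⟨t, htH⟩} : Set ↥(Subgroup.centralizer ({c} : Set ↥(unitaryGroupOfForm σ J))))) → Matrix (Fin 3) (Fin 3) K,
      ∀ τ, M τ = ((((τ : ↥(Subgroup.centralizer ({c} : Set ↥(unitaryGroupOfForm σ J)))) : ↥(unitaryGroupOfForm σ J)) : GL (Fin 3) K) : Matrix (Fin 3) (Fin 3) K) := ⟨_, fun _ => rfl⟩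
  have hMmul : ∀ τ₁ τ₂ : ↥(Subgroup.centralizer ({⟨t, htH⟩} : Set ↥(Subgroup.centralizer ({c} : Set ↥(unitaryGroupOfForm σ J))))), M (τ₁ * τ₂) = M τ₁ * M τ₂ := by
    intro τ₁ τ₂; rw [hMdef, hMdef, hMdef]; simp only [Subgroup.coe_mul, Units.val_mul]
  have hfacts : ∀ τ : ↥(Subgroup.centralizer ({⟨t, htH⟩} : Set ↥(Subgroup.centralizer ({c} : Set ↥(unitaryGroupOfForm σ J))))), Valued.v (M τ 0 0) = 1 ∧ Valued.v (M τ 2 0) ≤ 1 ∧ M τ 0 0 ≠ 0 ∧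
      σ (M τ 2 0 / (d * M τ 0 0)) = M τ 2 0 / (d * M τ 0 0) ∧
      ∃ e : K, Valued.v e = 1 ∧ M τ = !![M τ 0 0, 0, ρ * M τ 2 0; 0, e, 0; M τ 2 0, 0, M τ 0 0] := by
    intro τ
    have hτt : ((τ : ↥(Subgroup.centralizer ({c} : Set ↥(unitaryGroupOfForm σ J)))) : ↥(unitaryGroupOfForm σ J)) ∈ Subgroup.centralizer ({t} : Set ↥(unitaryGroupOfForm σ J)) := by
      rw [Subgroup.mem_centralizer_singleton_iff]
      exact congrArg Subtype.val (Subgroup.mem_centralizer_singleton_iff.1 τ.2)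
    obtain ⟨e, he⟩ := exists_coe_eq_rtorus_of_mem_centralizer σ h2 hc hte hC hBC (τ : ↥(Subgroup.centralizer ({c} : Set ↥(unitaryGroupOfForm σ J)))).2 hτt
    obtain ⟨h1, h2', h3, h4, h5⟩ := rtorus_v_facts σ hJ hd hdK hd0 hρ he
    rw [← hMdef] at he h1 h2' h4 h5
    exact ⟨h1, h2', h4, h5, e, h3, he⟩
  -- the coordinate `y(τ) = q ∕ (d p)`
  obtain ⟨Y, hYdef⟩ : ∃ Y : ↥(Subgroup.centralizer ({⟨t, htH⟩} : Set ↥(Subgroup.centralizer ({c} : Set ↥(unitaryGroupOfForm σ J))))) → K, ∀ τ, Y τ = M τ 2 0 / (d * M τ 0 0) := ⟨_, fun _ => rfl⟩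
  have hvY : ∀ τ : ↥(Subgroup.centralizer ({⟨t, htH⟩} : Set ↥(Subgroup.centralizer ({c} : Set ↥(unitaryGroupOfForm σ J))))), Valued.v (Y τ) = Valued.v (M τ 2 0) := by
    intro τ; rw [hYdef, map_div₀, map_mul, hvd, (hfacts τ).1, one_mul, div_one]
  have hY1 : ∀ τ : ↥(Subgroup.centralizer ({⟨t, htH⟩} : Set ↥(Subgroup.centralizer ({c} : Set ↥(unitaryGroupOfForm σ J))))), Valued.v (Y τ) ≤ 1 := fun τ => by rw [hvY]; exact (hfacts τ).2.1
  have hσY : ∀ τ : ↥(Subgroup.centralizer ({⟨t, htH⟩} : Set ↥(Subgroup.centralizer ({c} : Set ↥(unitaryGroupOfForm σ J))))), σ (Y τ) = Y τ := fun τ => by rw [hYdef]; exact (hfacts τ).2.2.2.1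
  have hvsmall : ∀ y₁ y₂ : K, Valued.v y₁ ≤ 1 → Valued.v y₂ ≤ 1 → Valued.v (π₀ * y₁ * y₂) < 1 := by
    intro y₁ y₂ hy₁ hy₂
    rw [map_mul, map_mul, hvπ₀]
    calc WithZero.exp (-1 : ℤ) * Valued.v y₁ * Valued.v y₂ ≤ WithZero.exp (-1 : ℤ) * 1 * 1 := by gcongr
      _ < 1 := by rw [mul_one, mul_one, ← WithZero.exp_zero, WithZero.exp_lt_exp]; norm_num
  -- the twisted addition law
  have hadd : ∀ τ₁ τ₂ : ↥(Subgroup.centralizer ({⟨t, htH⟩} : Set ↥(Subgroup.centralizer ({c} : Set ↥(unitaryGroupOfForm σ J))))), 1 + π₀ * Y τ₁ * Y τ₂ ≠ 0 ∧ Y (τ₁ * τ₂) = (Y τ₁ + Y τ₂) / (1 + π₀ * Y τ₁ * Y τ₂) := by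
    intro τ₁ τ₂
    obtain ⟨-, -, hp₁0, -, e₁, -, h₁⟩ := hfacts τ₁
    obtain ⟨-, -, hp₂0, -, e₂, -, h₂⟩ := hfacts τ₂
    obtain ⟨-, -, hp₁₂0, -, -⟩ := hfacts (τ₁ * τ₂)
    have e00 : M (τ₁ * τ₂) 0 0 = M τ₁ 0 0 * M τ₂ 0 0 + ρ * M τ₁ 2 0 * M τ₂ 2 0 := by
      rw [hMmul]
      conv_lhs => rw [h₁, h₂, block_mul_block]
      simp
    have e20 : M (τ₁ * τ₂) 2 0 = M τ₁ 2 0 * M τ₂ 0 0 + M τ₁ 0 0 * M τ₂ 2 0 := by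
      rw [hMmul]
      conv_lhs => rw [h₁, h₂, block_mul_block]
      simp
    have hD : 1 + π₀ * Y τ₁ * Y τ₂ = M (τ₁ * τ₂) 0 0 / (M τ₁ 0 0 * M τ₂ 0 0) := by
      rw [hYdef, hYdef, e00, hπ₀]; field_simp
    refine ⟨by rw [hD]; exact div_ne_zero hp₁₂0 (mul_ne_zero hp₁0 hp₂0), ?_⟩
    rw [hD, hYdef, hYdef, hYdef, e00, e20]
    field_simp
  -- the subgroup `S = T_H ∩ r_j K_H r_j⁻¹` and the integrality criterion `τ ∈ S ⟺ |q| ≤ |ϖ^j|`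
  set S : Subgroup ↥(Subgroup.centralizer ({⟨t, htH⟩} : Set ↥(Subgroup.centralizer ({c} : Set ↥(unitaryGroupOfForm σ J))))) := ((((flickerKH σ J c).subgroupOf (Subgroup.centralizer ({c} : Set ↥(unitaryGroupOfForm σ J))))).map
    (MulAut.conj (r j)).toMonoidHom).subgroupOf (Subgroup.centralizer ({⟨t, htH⟩} : Set ↥(Subgroup.centralizer ({c} : Set ↥(unitaryGroupOfForm σ J))))) with hSdef
  have hS : ∀ τ : ↥(Subgroup.centralizer ({⟨t, htH⟩} : Set ↥(Subgroup.centralizer ({c} : Set ↥(unitaryGroupOfForm σ J))))), τ ∈ S ↔ Valued.v (M τ 2 0) ≤ Valued.v (ϖ ^ j) := by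
    intro τ
    obtain ⟨hvp, hvq, hp0, -, e, hve, hM⟩ := hfacts τ
    rw [hSdef, Subgroup.mem_subgroupOf, Subgroup.mem_map_equiv, Subgroup.mem_subgroupOf, mem_flickerKH_iff,
      mem_unitaryInt_iff_forall_v_apply_le_one σ hJ hd.vσ]
    obtain ⟨a, hj | hj⟩ := Nat.even_or_odd' j
    · -- `j = 2a`
      subst hj
      have hϖa0 : ϖ ^ a ≠ 0 := pow_ne_zero _ hϖ0
      have hrinv : (((((r (2 * a))⁻¹ : ↥(Subgroup.centralizer ({c} : Set ↥(unitaryGroupOfForm σ J)))) : ↥(unitaryGroupOfForm σ J)) : GL (Fin 3) K) : Matrix (Fin 3) (Fin 3) K) =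
          !![ϖ ^ a, 0, 0; 0, 1, 0; 0, 0, (ϖ ^ a)⁻¹] := by
        rw [Subgroup.coe_inv, Subgroup.coe_inv, Matrix.coe_units_inv, hr0 a]
        refine Matrix.inv_eq_left_inv ?_
        rw [block_mul_block]
        ext x y
        fin_cases x <;> fin_cases y <;> simp [hϖa0]
      have hconj : (((((MulAut.conj (r (2 * a))).symm (τ : ↥(Subgroup.centralizer ({c} : Set ↥(unitaryGroupOfForm σ J)))) : ↥(Subgroup.centralizer ({c} : Set ↥(unitaryGroupOfForm σ J)))) : ↥(unitaryGroupOfForm σ J)) : GL (Fin 3) K) : Matrix (Fin 3) (Fin 3) K) =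
          !![M τ 0 0, 0, ϖ ^ a * (ρ * M τ 2 0) * ϖ ^ a; 0, e, 0; (ϖ ^ a)⁻¹ * M τ 2 0 * (ϖ ^ a)⁻¹, 0, M τ 0 0] := by
        rw [MulAut.conj_symm_apply, Subgroup.coe_mul, Subgroup.coe_mul, Subgroup.coe_mul, Subgroup.coe_mul, Units.val_mul, Units.val_mul,
          hrinv, hr0 a, ← hMdef τ, hM, block_mul_block, block_mul_block]
        ext x y
        fin_cases x <;> fin_cases y <;> simp <;> (try field_simp)
      rw [hconj, forall_v_conjEven_le_one_iff hϖ0 hvϖ1 hvp.le hve hvρ1, ← map_mul, ← pow_add, show a + a = 2 * a by ring]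
      exact ⟨fun h => h.2, fun h => ⟨((MulAut.conj (r (2 * a))).symm (τ : ↥(Subgroup.centralizer ({c} : Set ↥(unitaryGroupOfForm σ J))))).2, h⟩⟩
    · -- `j = 2a + 1`
      subst hj
      have hϖa0 : ϖ ^ (a + 1) ≠ 0 := pow_ne_zero _ hϖ0
      have hrinv : (((((r (2 * a + 1))⁻¹ : ↥(Subgroup.centralizer ({c} : Set ↥(unitaryGroupOfForm σ J)))) : ↥(unitaryGroupOfForm σ J)) : GL (Fin 3) K) : Matrix (Fin 3) (Fin 3) K) =
          !![0, 0, -ϖ ^ (a + 1) / d; 0, 1, 0; d * (ϖ ^ (a + 1))⁻¹, 0, 0] := by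
        rw [Subgroup.coe_inv, Subgroup.coe_inv, Matrix.coe_units_inv, hr1 a]
        refine Matrix.inv_eq_left_inv ?_
        rw [block_mul_block]
        ext x y
        fin_cases x <;> fin_cases y <;> simp <;> (try field_simp)
      have hconj : (((((MulAut.conj (r (2 * a + 1))).symm (τ : ↥(Subgroup.centralizer ({c} : Set ↥(unitaryGroupOfForm σ J)))) : ↥(Subgroup.centralizer ({c} : Set ↥(unitaryGroupOfForm σ J)))) : ↥(unitaryGroupOfForm σ J)) : GL (Fin 3) K) : Matrix (Fin 3) (Fin 3) K) =
          !![M τ 0 0, 0, -(M τ 2 0 * ϖ ^ (a + 1) * ϖ ^ (a + 1) / d ^ 2); 0, e, 0;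
            -(ρ * M τ 2 0 * d ^ 2 / (ϖ ^ (a + 1) * ϖ ^ (a + 1))), 0, M τ 0 0] := by
        rw [MulAut.conj_symm_apply, Subgroup.coe_mul, Subgroup.coe_mul, Subgroup.coe_mul, Subgroup.coe_mul, Units.val_mul, Units.val_mul,
          hrinv, hr1 a, ← hMdef τ, hM, block_mul_block, block_mul_block]
        ext x y
        fin_cases x <;> fin_cases y <;> simp <;> (try field_simp)
      have epow : Valued.v (ϖ ^ (a + 1)) * Valued.v (ϖ ^ (a + 1)) = Valued.v ϖ * Valued.v (ϖ ^ (2 * a + 1)) := by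
        have e1 : ϖ ^ (a + 1) * ϖ ^ (a + 1) = ϖ * ϖ ^ (2 * a + 1) := by ring
        rw [← map_mul, e1, map_mul]
      rw [hconj, forall_v_conjOdd_le_one_iff hϖ0 hvϖ1 hvp.le hve hvq hvd, hρ, epow]
      constructor
      · rintro ⟨-, h⟩
        exact le_of_mul_le_mul_left₀'' hvϖ0 h
      · intro h
        exact ⟨((MulAut.conj (r (2 * a + 1))).symm (τ : ↥(Subgroup.centralizer ({c} : Set ↥(unitaryGroupOfForm σ J))))).2, mul_le_mul_right h _⟩
  -- the lift `K ⊇ {|·| ≤ 1} → R` and the invariant `f τ = y(τ) mod 𝔪^j`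
  obtain ⟨L, hL⟩ : ∃ L : K → R, ∀ y : K, Valued.v y ≤ 1 → ι (L y) = y :=
    ⟨fun y => if h : Valued.v y ≤ 1 then Classical.choose ((hιv y).1 h) else 0, fun y hy => by
      simp only [dif_pos hy]; exact Classical.choose_spec ((hιv y).1 hy)⟩
  have hLι : ∀ x : R, L (ι x) = x := fun x => hι (hL _ (TorusBridge.v_le_one ι hιv x))
  have hσI : maximalIdeal R ^ j ≤ (maximalIdeal R ^ j).comap σR := maximalIdeal_pow_le_comap σR hσR j
  obtain ⟨f, hfdef⟩ : ∃ f : ↥(Subgroup.centralizer ({⟨t, htH⟩} : Set ↥(Subgroup.centralizer ({c} : Set ↥(unitaryGroupOfForm σ J))))) → R ⧸ maximalIdeal R ^ j, ∀ τ, f τ = Ideal.Quotient.mk (maximalIdeal R ^ j) (L (Y τ)) := ⟨_, fun _ => rfl⟩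
  -- `f τ₁ = f τ₂ ⟺ τ₁⁻¹τ₂ ∈ S`
  have hf : ∀ τ₁ τ₂ : ↥(Subgroup.centralizer ({⟨t, htH⟩} : Set ↥(Subgroup.centralizer ({c} : Set ↥(unitaryGroupOfForm σ J))))), f τ₁ = f τ₂ ↔ τ₁⁻¹ * τ₂ ∈ S := by
    intro τ₁ τ₂
    rw [hfdef, hfdef, Ideal.Quotient.eq, TorusBridge.mem_maximalIdeal_pow_iff_v_le ι hι hιv hϖR, map_sub, hL _ (hY1 τ₁), hL _ (hY1 τ₂),
      hιϖ, hS, ← hvY (τ₁⁻¹ * τ₂)]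
    obtain ⟨hD, hlaw⟩ := hadd τ₁ (τ₁⁻¹ * τ₂)
    rw [mul_inv_cancel_left] at hlaw
    have key : Y (τ₁⁻¹ * τ₂) * (1 - π₀ * Y τ₁ * Y τ₂) = Y τ₂ - Y τ₁ := by
      have h3 := hlaw
      rw [eq_div_iff hD] at h3
      linear_combination (-1 : K) * h3
    have hunit : Valued.v (1 - π₀ * Y τ₁ * Y τ₂) = 1 := by
      rw [sub_eq_add_neg, Valuation.map_one_add_of_lt]
      rw [Valuation.map_neg]; exact hvsmall _ _ (hY1 τ₁) (hY1 τ₂)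
    have e1 : Valued.v (Y τ₁ - Y τ₂) = Valued.v (Y (τ₁⁻¹ * τ₂)) := by
      rw [← Valuation.map_neg, neg_sub, ← key, map_mul, hunit, mul_one]
    rw [e1]
  -- the range of `f` is the set of `σ̄`-fixed classes
  have hrange : Set.range f = {x : R ⧸ maximalIdeal R ^ j | Ideal.quotientMap (maximalIdeal R ^ j) σR hσI x = x} := by
    ext x
    constructor
    · rintro ⟨τ, rfl⟩
      have hfix : σR (L (Y τ)) = L (Y τ) := hι (by rw [hσι, hL _ (hY1 τ), hσY])
      show Ideal.quotientMap (maximalIdeal R ^ j) σR hσI (f τ) = f τ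
      rw [hfdef, Ideal.quotientMap_mk, hfix]
    · intro hx
      obtain ⟨x₀, rfl⟩ := Ideal.Quotient.mk_surjective x
      have hx' : σR x₀ - x₀ ∈ maximalIdeal R ^ j := by
        rw [← Ideal.Quotient.eq]
        have h1 : Ideal.quotientMap (maximalIdeal R ^ j) σR hσI (Ideal.Quotient.mk (maximalIdeal R ^ j) x₀) =
            Ideal.Quotient.mk (maximalIdeal R ^ j) x₀ := hx
        rwa [Ideal.quotientMap_mk] at h1
      obtain ⟨r₀, hr₀σ, hr₀⟩ := exists_fixed_sub_mem σR hσR ha hx'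
      -- the torus element with coordinate `y₀ = ι r₀`
      have hσy₀ : σ (ι r₀) = ι r₀ := by rw [← hσι, hr₀σ]
      have hvy₀ : Valued.v (ι r₀) ≤ 1 := TorusBridge.v_le_one ι hιv r₀
      have hνlt : Valued.v ((1 - π₀ * ι r₀ * ι r₀) - 1) < 1 := by
        have e1 : (1 - π₀ * ι r₀ * ι r₀) - 1 = -(π₀ * ι r₀ * ι r₀) := by ring
        rw [e1, Valuation.map_neg]; exact hvsmall _ _ hvy₀ hvy₀
      obtain ⟨μ, hμ, hvμ⟩ := exists_mul_map_eq_of_v_sub_one_lt σ ι hι hιv σR hσR hσι h2R (x := 1 - π₀ * ι r₀ * ι r₀)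
        (by rw [map_sub, map_one, map_mul, map_mul, hσπ₀, hσy₀]) hνlt
      have hμ0 : μ ≠ 0 := fun h0 => by rw [h0, map_zero] at hvμ; exact zero_ne_one hvμ
      have hσμ0 : σ μ ≠ 0 := (map_ne_zero σ).2 hμ0
      have hN' : μ⁻¹ * σ μ⁻¹ * (1 * 1 - π₀ * ι r₀ * ι r₀) = 1 := by
        rw [map_inv₀]
        have e1 : 1 * 1 - π₀ * ι r₀ * ι r₀ = μ * σ μ := by rw [hμ]; ring
        rw [e1]; field_simp
      obtain ⟨τ₀, hτ₀⟩ := exists_coe_eq_ramifiedTorusBlock σ hJ hdK hd0 (x := 1) (y := ι r₀) (lam := μ⁻¹) (map_one σ) hσy₀ hσπ₀ hN'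
      have hτ₀H : τ₀ ∈ Subgroup.centralizer ({c} : Set ↥(unitaryGroupOfForm σ J)) := mem_centralizer_of_coe_eq_block σ hc hτ₀
      have hτ₀t : τ₀ ∈ Subgroup.centralizer ({t} : Set ↥(unitaryGroupOfForm σ J)) := ramifiedTorusBlock_mem_centralizer σ hd0 hτ₀ hte hC hBC hπ₀
      have hτ₀T : (⟨τ₀, hτ₀H⟩ : ↥(Subgroup.centralizer ({c} : Set ↥(unitaryGroupOfForm σ J)))) ∈ Subgroup.centralizer ({⟨t, htH⟩} : Set ↥(Subgroup.centralizer ({c} : Set ↥(unitaryGroupOfForm σ J)))) := by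
        rw [Subgroup.mem_centralizer_singleton_iff]
        exact Subtype.ext (Subgroup.mem_centralizer_singleton_iff.1 hτ₀t)
      refine ⟨⟨⟨τ₀, hτ₀H⟩, hτ₀T⟩, ?_⟩
      have hM₀ : M ⟨⟨τ₀, hτ₀H⟩, hτ₀T⟩ = ((τ₀ : GL (Fin 3) K) : Matrix (Fin 3) (Fin 3) K) := hMdef _
      have hY₀ : Y ⟨⟨τ₀, hτ₀H⟩, hτ₀T⟩ = ι r₀ := by
        rw [hYdef, hM₀, hτ₀]
        simp
        field_simp
      rw [hfdef, hY₀, hLι, Ideal.Quotient.eq]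
      exact hr₀
  -- count
  change S.index = q₀ ^ j
  rw [index_eq_natCard_range S f hf, hrange]
  exact natCard_fixed_quotient_pow σR hσR ha hq j

end Weight

end Literature.NumberTheory.Automorphic.UnitaryGroup
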